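import Literature.MathematicalPhysics.QuantumFieldTheory.Balaban1983to89.B8Prop6DentedCubeMemberGammaRec
import Literature.MathematicalPhysics.QuantumFieldTheory.Balaban1983to89.B8Prop6CubeMemberEq137Rec
import Literature.MathematicalPhysics.QuantumFieldTheory.Balaban1983to89.B8Eq131DerivationRec
import Literature.MathematicalPhysics.QuantumFieldTheory.Balaban1983to89.B8Prop6DentedCubeMemberGauged

/-!
# `Balaban1983to89.B8Prop6DentedCubeMemberGaugedRec` — RECORD TWIN of `B8Prop6DentedCubeMemberGauged` ([Balaban1985RegularSpaces] PROPOSITION 6 (1.135)–(1.138) ∕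
# [Balaban1985Variational] (152)–(153) AT THE DENTED CUBE MEMBER: (1.137)'s identity ON THE BONDS OF `□^{(k)}` OVER `Ω_k` and the assembly `Node00.GaugedBoundB8DZ` from a gauge
# transformation with Theorem 4's clauses) FOR THE SYMMETRISED CENTRED block averaging (0.4) of [Balaban1987RG1]

statement-level skeleton of published theorems with citation tags; proofs where landed; nothing here is a claim about the Yang–Mills mass gap

T. Bałaban, *Spaces of regular gauge field configurations on a lattice and gauge fixing conditions*, Commun. Math. Phys. **99** (1985) 75–102 `[Balaban1985RegularSpaces]`
("[6]"): Prop. 6 (1.135)–(1.138) p. 99, (1.37) p. 82, (1.29) p. 81, (1.132)–(1.133) p. 99, (1.62) p. 87; T. Bałaban, *Averaging operations for lattice gauge theories*, Commun. Math.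
Phys. **98** (1985) 17–51 `[Balaban1985Averaging]` ("[3]"): (43) p. 24, (87) p. 31, (127) p. 37; T. Bałaban, *The variational problem and background fields in renormalization group
method for lattice gauge theories*, Commun. Math. Phys. **102** (1985) 277–309 `[Balaban1985Variational]` ("[15]"): (148)–(153) p. 301; T. Bałaban, *Renormalization group approach
to lattice gauge field theories. I*, Commun. Math. Phys. **109** (1987) 249–301 `[Balaban1987RG1]` ("[I]"): (0.3)–(0.4) pp. 252–253.  STATUS: published.

CITATION HEADER (lean-in-tree rule).  Cell `pub-ymgap`, «N05-REC» stage 2 (director-ym №254∕№255∕№288), item R6 (the crown road), module (g)-1 of the lead pen's `R6-PLAN.md`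
— typed by the LEAD PEN dag-n05-e g38 on dag-n05-c's recipe (inventory `N05-REC-INVENTORY.md` §R6 row `B8Prop6DentedCubeMemberGauged`: class A = `gaugedBoundB8D_of_clauses
avgIter_cutFixed_eq_avgIter_axial logCovIter_eq_mlog_avgIter_dentedMember`).  WHAT IS REPRODUCED = ✓ the engine module's §1 (locality `Ū₀″ᵏ = Ū₀′ᵏ` on `□^{(k)}` over
`B8Ineq133Rec.avgIterZ_eq_of_agree`), §2 (the identity at the dented RECORD datum `c : Node00.CubeB8DZ` over the γ root `B8Prop6DentedCubeMemberGammaRec.thm4_hypotheses_one_cutFixed_dented_γ`,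
`B8Eq131DerivationRec.eq87_of_inAxZ_restr129Z`, the centred geometry and generic identity of `B8Prop6CubeMemberEq137Rec`) and §3 (assembly by `Node00.gaugedBoundB8DZ_intro`).
TOKEN MAP: `avgIter ∕ logCovIter ∕ cutFixed ∕ localGauge ∕ towerGauge ∕ Restr129 ∕ InAx ∕ IsLandau138W ↦ …Z`; corner boxes and blocks ↦ CENTRED (`bLoZ ∕ bHiZ`, the bond box
`[Lᵏx − c_k𝟙, Lᵏx + Lᵏe_μ + c_k𝟙]`, `UnderZ`); `(hL : 2 ≤ L) ↦ (hLs : L = 2s+1) (hs : 1 ≤ s)`; [3] Prop. 4's flat window `16·C₁·α₂ ≤ 1`, `2α₂ ≤ c₃` ↦ the record's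
`4·C₁·KZ²·α₂ ≤ 1`, `KZ·α₂ ≤ c₃` (`C₁ = 131072(d+1)²`, `KZ = 2(1 + 2gZ)`).  Declaration names = engine names (T5).  Kind «kernel-checked proof», theorems only; no `def`, no
`instance`, no `notation`, no existing module modified.  `--supports stmt-QuantumFields-20541` (K0⁷-keyed, COUNT-NEUTRAL).

HONEST SCOPE: by-name compositions; NO estimate; (1.137)'s INEQUALITY is not concluded at the dented member (`GaugedBoundB8DZ` does not ask it); nothing of [6]∕[15] asserted;
`HThm4Rec` UNDISCHARGED; caveat (C-S3-1) + addendum v4 stand; N05 [B8] DISCHARGED OF RECORD untouched; N05 ∕ N07 NOT discharged; COUNT of record unmoved · K numerically unchanged;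
one finite `𝕋⁴` programme at fixed `ε`, Bałaban AS PRINTED; nothing continuum ∕ ℝ⁴ ∕ OS ∕ mass-gap ∕ Clay.  No `sorry`, no `def`.

[cite: Balaban1985RegularSpaces, Prop. 6 (1.135)–(1.138) p.99, (1.37) p.82, (1.29) p.81, (1.62) p.87; Balaban1985Averaging, (43) p.24, (87) p.31, (127) p.37; Balaban1985Variational, (148)–(153) p.301; Balaban1987RG1, (0.3)–(0.4) pp.252–253]
-/

noncomputable section

open NormedSpace

namespace Literature.MathematicalPhysics.QuantumFieldTheory.Balaban1983to89.B8Prop6DentedCubeMemberGaugedRec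

open Complex (I)
open MatrixLog B7Prop1Explicit B7Prop2Explicit B7Prop1Local B7AvgGaugeCovariance
open B7Eq92Concrete (mgauge mgauge_one_left)
open B7Prop2Explicit (c2' unitaryUnits)
open B7Prop2Rec (AvgClosedZ C0Z avgClosedZ_unitaryUnits)
open B7Prop3Flat (expCfg c3)
open B7Prop4GeneralLevelsRec (cZ gZ KZ gZ_nonneg)
open B7Prop5Flat (BondIn)
open BlockAveragingZd (avgIterZ ctrShift)
open B7SectCDGaugeAveragesRec (wrecZ)
open B7SectEFLinearisationRec (logCovIterZ)
open B8Ineq130Rec (tlo thi)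
open B8Ineq130 (gaugeAct_one)
open B8Ineq132 (InAk)
open B8Ineq133 (cutCfg_agree)
open B8Ineq133Rec (cutFixedZ avgIterZ_eq_of_agree)
open B8Eq115GaugeFixing (gaugeAct_mul gaugeAct_agree gaugeAct_mem_of)
open B8Eq115GaugeFixingRec (localGaugeZ towerGaugeZ)
open B8Eq119TwistedAxialRec (InAxZ Restr129Z UnderZ)
open B8Eq131DerivationRec (eq87_of_inAxZ_restr129Z)
open B8Eq146AExpansion (iEta)
open B8Eq184Proof (cfgExp)
open B8Eq140Level (SideTouches sideTouches_of_bondTouches)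
open B8Eq138LandauZd (logCfg covLap)
open B8Eq138LandauZdRec (IsLandau138WZ)
open B8Eq131Cubes (tLo tHi ctr)
open B8Eq131CubesRec (bLoZ bHiZ tLo_eq tHi_eq le_of_margin_mono)
open B8Lemma1NonAbelian (mulCfg)
open B8Prop6OfThm4 (const_136)
open B8LeafModelZd3 (mlogCfg mlogCfg_spec)
open B8Prop6CubeMemberEq137Rec (logCovIter_one_eq_mlog_avgIter_loc_of_window inBox_sq_top_of_bond mem_cubeZ_top_of_bondBox under_or_under_of_inBox_bondBoxZ)
open B8Prop6DentedCubeMemberGammaRec (thm4_hypotheses_one_cutFixed_dented_γ)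
open B8DentedCubeMemberZdRec (lamST_top_apply)
open Node00 (CubeB8DZ GaugedBoundB8DZ gaugedBoundB8DZ_intro)

-- `Site` alone could resolve to the torus sites of `Setup.lean`; re-export the `ℤ^d` sites of `B7Prop1Explicit`.
export B7Prop1Explicit (Site)

variable {d : ℕ}

/-! ## §1 Locality: `Ū₀″ᵏ = Ū₀′ᵏ` on the bonds of `□^{(k)}`, RECORD averages -/

section Locality

variable {𝔸 : Type*} [CStarAlgebra 𝔸]

/-- (RECORD TWIN of `B8Prop6DentedCubeMemberGauged.avgIter_cutFixed_eq_avgIter_axial`.) **`Ū₀″ᵏ(x, μ) = Ū₀′ᵏ(x, μ)` ON THE BONDS OF `□^{(k)}`, RECORD AVERAGES** (`U₀″ = U₀′` on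
the centred `□̃ ⊃ Bᵏ(x) ∪ Bᵏ(x + e_μ)`; locality (43) of [3] for the (0.4) average, `B8Ineq133Rec.avgIterZ_eq_of_agree`): needs NO «□ ⊂ Ω_k» (odd `L = 2s+1`).
[cite: Balaban1985RegularSpaces, p.99 («equal to U₀′ on □̃»), (1.137) p.99; Balaban1985Averaging, p.24 (sentence after (43)); Balaban1987RG1, (0.4) p.253] -/
theorem avgIter_cutFixed_eq_avgIter_axial {L s : ℕ} (hLs : L = 2 * s + 1) (k : ℕ) (U₀ : Site d → Fin d → 𝔸ˣ) (a : Site d) {M : ℕ} (ρ : ℕ)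
    (x : Site d) (μ : Fin d) (hx : bLoZ L a 0 0 ≤ x) (hx' : x + e μ ≤ bHiZ L a M 0 0) :
    avgIterZ L (cutFixedZ L (tLo a ρ) (tHi a M ρ) U₀ k (ctr a M)) k x μ =
      avgIterZ L (gaugeAct (localGaugeZ L (tLo a ρ) (tHi a M ρ) U₀ k (ctr a M)) U₀) k x μ := by
  set Uc := clampCfg (tlo L (tLo a ρ) k) (thi L (tHi a M ρ) k) U₀ with hUc
  have hagc : AgreeOn (tlo L (tLo a ρ) k) (thi L (tHi a M ρ) k) (gaugeAct (towerGaugeZ L Uc k (ctr a M)) Uc)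
      (gaugeAct (localGaugeZ L (tLo a ρ) (tHi a M ρ) U₀ k (ctr a M)) U₀) :=
    gaugeAct_agree (clampCfg_agree U₀) _
  have hsub0 : tLo a ρ ≤ bLoZ L a 0 0 ∧ bHiZ L a M 0 0 ≤ tHi a M ρ := by
    rw [tLo_eq L, tHi_eq L]
    exact le_of_margin_mono (Nat.zero_le _)
  have hxt : tlo L (tLo a ρ) 0 ≤ x := fun i => (hsub0.1 i).trans (hx i)
  have hxt' : x + e μ ≤ thi L (tHi a M ρ) 0 := fun i => (hx' i).trans (hsub0.2 i)
  have hag'' : AgreeOn (tlo L (tLo a ρ) k) (thi L (tHi a M ρ) k) (cutFixedZ L (tLo a ρ) (tHi a M ρ) U₀ k (ctr a M))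
      (gaugeAct (towerGaugeZ L Uc k (ctr a M)) Uc) :=
    fun z κ hz hz' => (cutCfg_agree _ _ _ z κ hz hz').trans (hagc.symm z κ hz hz')
  have e1 := avgIterZ_eq_of_agree hLs hag'' (Nat.zero_le k) hxt hxt'
  have e2 := avgIterZ_eq_of_agree hLs hagc.symm (Nat.zero_le k) hxt hxt'
  rw [Nat.sub_zero] at e1 e2
  exact e1.trans e2.symm

end Locality

/-! ## §2 (1.137)'s identity at the dented RECORD member, on the bonds of `□^{(k)}` over `Ω_k` -/

section Identity

variable {𝔸 : Type*} [CStarAlgebra 𝔸] [Nontrivial 𝔸]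

omit [Nontrivial 𝔸] in
/-- The two exponent-field spellings agree bondwise (private plumbing, as in the engine). [folklore] -/
private theorem expCfg_iEta_apply (η : ℝ) (A : Site d → Fin d → 𝔸) (x : Site d) (κ : Fin d) :
    expCfg (iEta η A) x κ = cfgExp η A x κ :=
  congrFun (congrFun (B8Prop3GaugeFixedKLevel.expCfg_iEta_eq_cfgExp η A) x) κ

/-- (RECORD TWIN of `B8Prop6DentedCubeMemberGauged.logCovIter_eq_mlog_avgIter_dentedMember`.) ★ **THE IDENTITY OF (1.137) «Q_k(ηA) = (1∕i) log Ū₀″ᵏ» AT THE DENTED RECORD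
MEMBER, ON THE BONDS OF `□^{(k)}` WHOSE TWO CENTRED `k`-BLOCKS LIE IN `Ω_k`** — the clause of `GaugedBoundB8DZ` (with `Ū₀″ᵏ`; §1 turns it into `Ū₀′ᵏ`).  DATUM: the dented
record datum `c` (`□̃ ⊂ Ω_{k−1}`, `L ≤ ρ ≤ M`, `11d < M`, odd `L = 2s+1`, `s ≥ 1`), unitary `U₀ ∈ 𝔄_k({Ω_j}, α₀)` in the (1.130)-regime (so
`thm4_hypotheses_one_cutFixed_dented_γ` supplies (1.132)'s axial class for `U₀″` on the dented record cells).  ON `u`, `A`: (1.29)∕(152) `Restr129Z L c.k c.lamS 1 u`;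
`U₀″^{u⁻¹} = e^{iηA}` with `|A| ≤ α₂(Lᵏη)⁻¹` on the bonds of the plaquettes touching `Ω′_k = □_k ∩ Ω_k` ((1.62)-shape, top level); the record window `4·C₁·KZ²·α₂ ≤ 1`,
`KZ·α₂ ≤ c₃(d, L)`.  CONCLUSION: for every bond `⟨x, x + e_μ⟩ ⊂ □^{(k)}` with `c.inTop x`, `c.inTop (x + e_μ)`: `Q_k(1, iηA)(x, μ) = log Ū₀″ᵏ(x, μ)`, record averages.
PROOF = the engine's: (87) at `x`, `x + e_μ ∈ Λ′_k` (`eq87_of_inAxZ_restr129Z` on the dented record cells), the centred fine box of the bond inside `□_k ∩ Ω_k` (its two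
centred blocks), and the generic tower-local identity `B8Prop6CubeMemberEq137Rec.logCovIter_one_eq_mlog_avgIter_loc_of_window`.
[cite: Balaban1985RegularSpaces, Prop. 6 (1.137) p.99, (1.37) p.82, (1.29) p.81, (1.132) p.99; Balaban1985Variational, (152)–(153) p.301; Balaban1985Averaging, (127) p.37, (87) p.31; Balaban1987RG1, (0.3)–(0.4) pp.252–253] -/
theorem logCovIter_eq_mlog_avgIter_dentedMember (hd2 : 2 ≤ d) {L s : ℕ} (hLs : L = 2 * s + 1) (hs : 1 ≤ s) {K : ℕ} {Ω : ℕ → Set (Site d)}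
    (c : CubeB8DZ d L K Ω)
    (U₀ : Site d → Fin d → 𝔸ˣ) (hU₀ : ∀ x κ, U₀ x κ ∈ unitaryUnits 𝔸) {α₀ : ℝ} (hα : 0 < α₀)
    (hα3 : C0Z d * (α₀ * (L : ℝ) ^ 2) ≤ 1 / 3) (hα2 : 2 * (α₀ * (L : ℝ) ^ 2) ≤ c2' d L)
    {η : ℝ} (hη : 0 < η) (hA : InAk L c.k η α₀ Ω U₀)
    (hsmall : 11 * (d : ℝ) ^ 2 * (L : ℝ) ^ 2 * α₀ + ((c.M : ℝ) + 4 * c.ρ) * d * (L : ℝ) ^ 2 * α₀ ≤ 1 / 6)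
    (u : Site d → 𝔸ˣ) (h129 : Restr129Z L c.k c.lamS (1 : Site d → Fin d → 𝔸ˣ) u)
    (A : Site d → Fin d → 𝔸) {α₂ : ℝ} (hα₂ : 0 ≤ α₂)
    (h4 : 4 * (131072 * ((d : ℝ) + 1) ^ 2) * (KZ d L) ^ 2 * α₂ ≤ 1) (hc₃ : KZ d L * α₂ ≤ c3 d L)
    (h162 : ∀ (z : Site d) (ν : Fin d), SideTouches (c.sq c.k) z ν →
      gaugeAct u⁻¹ (cutFixedZ L (tLo c.a c.ρ) (tHi c.a c.M c.ρ) U₀ c.k (ctr c.a c.M)) z ν = cfgExp η A z ν ∧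
        ‖A z ν‖ ≤ α₂ * ((L : ℝ) ^ c.k * η)⁻¹)
    (x : Site d) (μ : Fin d) (hx : bLoZ L c.a 0 0 ≤ x) (hx' : x + e μ ≤ bHiZ L c.a c.M 0 0) (hix : c.inTop x) (hix' : c.inTop (x + e μ)) :
    logCovIterZ L (1 : Site d → Fin d → 𝔸ˣ) (iEta η A) c.k x μ =
      mlog ((avgIterZ L (cutFixedZ L (tLo c.a c.ρ) (tHi c.a c.M c.ρ) U₀ c.k (ctr c.a c.M)) c.k x μ : 𝔸ˣ) : 𝔸) := by
  have hL : Odd L := ⟨s, by omega⟩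
  have hL1 : 1 ≤ L := by omega
  have hd1 : 1 ≤ d := le_trans (by norm_num) hd2
  have hG : AvgClosedZ d L (unitaryUnits 𝔸) := avgClosedZ_unitaryUnits d L
  set U'' := cutFixedZ L (tLo c.a c.ρ) (tHi c.a c.M c.ρ) U₀ c.k (ctr c.a c.M) with hU''
  have hgU : gaugeAct u (gaugeAct u⁻¹ U'') = U'' := by rw [← gaugeAct_mul, mul_inv_cancel, gaugeAct_one]
  -- (1.132)'s axial class for `U₀″` on the dented record cells, and (87) at the sites of `Λ′_k`
  obtain ⟨-, -, -, hAx, -, -⟩ := thm4_hypotheses_one_cutFixed_dented_γ hLs hs hd1 c U₀ hU₀ hα hα3 hα2 hη hA hsmall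
  have hT : c.lamST c.k = c.lamS := funext fun j => lamST_top_apply c j
  have hAx' : InAxZ L c.k c.lamS (1 : Site d → Fin d → 𝔸ˣ)
      (mgauge (1 : Site d → Fin d → 𝔸ˣ) u (gaugeAct u⁻¹ U'') * (1 : Site d → Fin d → 𝔸ˣ)) := by
    rw [mgauge_one_left, hgU, ← hT]
    exact hAx c.k le_rfl
  have h87 := eq87_of_inAxZ_restr129Z hLs c.k c.lamS (1 : Site d → Fin d → 𝔸ˣ) (gaugeAct u⁻¹ U'') u hAx' h129
  -- both ends are level-`k` DENTED cells: in `□_k^{(k)}` (indeed in `□^{(k)}`) with their centred blocks in `Ω_k`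
  obtain ⟨hxΛ, hxΛ'⟩ := inBox_sq_top_of_bond L c.a c.M c.ρ c.k hx hx'
  have hxD : x ∈ c.lamS c.k := (c.mem_lamS_top_iff x).2 ⟨hxΛ, hix⟩
  have hxD' : x + e μ ∈ c.lamS c.k := (c.mem_lamS_top_iff (x + e μ)).2 ⟨hxΛ', hix'⟩
  have hm := h87 c.k le_rfl x hxD
  have hp := h87 c.k le_rfl (x + e μ) hxD'
  obtain ⟨j, hj⟩ : ∃ j, c.k = j + 1 := ⟨c.k - 1, by have := c.one_le_k; omega⟩
  -- on the centred fine box of the bond: `U₁ = e^{iηA}`, `‖iηA‖ ≤ α₂L^{−k}` (the box lies in `□_k ∩ Ω_k`)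
  set b : ℝ := α₂ * ((L : ℝ) ^ c.k)⁻¹ with hb_def
  have hLpos : (0 : ℝ) < L := by exact_mod_cast hL1
  have hb0 : 0 ≤ b := by positivity
  have hLb : (L : ℝ) ^ c.k * b = α₂ := by rw [hb_def]; field_simp
  haveI : Nontrivial (Fin d) := Fin.nontrivial_iff_two_le.mpr hd2
  have hsqk : ∀ z, InBox (fun i => (L : ℤ) ^ c.k * x i - (ctrShift L c.k : ℤ))
      (fun i => (L : ℤ) ^ c.k * x i + (ctrShift L c.k : ℤ) + if i = μ then (L : ℤ) ^ c.k else 0) z → z ∈ c.sq c.k := by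
    intro z hz
    rw [c.sq_top]
    refine ⟨mem_cubeZ_top_of_bondBox hL c.a c.M c.ρ c.k hx hx' hz, ?_⟩
    rcases under_or_under_of_inBox_bondBoxZ hL hz with h | h
    · exact hix z h
    · exact hix' z h
  have hbox : ∀ z ν, BondIn (fun i => (L : ℤ) ^ c.k * x i - (ctrShift L c.k : ℤ))
      (fun i => (L : ℤ) ^ c.k * x i + (ctrShift L c.k : ℤ) + if i = μ then (L : ℤ) ^ c.k else 0) z ν →
      gaugeAct u⁻¹ U'' z ν = expCfg (iEta η A) z ν ∧ ‖iEta η A z ν‖ ≤ b := by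
    intro z ν hz
    obtain ⟨κ, hκ⟩ := exists_ne ν
    obtain ⟨hW, hAz⟩ := h162 z ν (sideTouches_of_bondTouches hκ (Or.inl (hsqk z hz.1)))
    refine ⟨by rw [expCfg_iEta_apply]; exact hW, ?_⟩
    have hLj : (0 : ℝ) < (L : ℝ) ^ c.k := by positivity
    show ‖((I : ℂ) * η) • A z ν‖ ≤ b
    rw [norm_smul, norm_mul, Complex.norm_I, one_mul, Complex.norm_real, Real.norm_eq_abs, abs_of_pos hη, hb_def]
    calc η * ‖A z ν‖ ≤ η * (α₂ * ((L : ℝ) ^ c.k * η)⁻¹) := mul_le_mul_of_nonneg_left hAz hη.le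
      _ = α₂ * ((L : ℝ) ^ c.k)⁻¹ := by field_simp
  have hU₁E : AgreeOn (fun i => (L : ℤ) ^ c.k * x i - (ctrShift L c.k : ℤ))
      (fun i => (L : ℤ) ^ c.k * x i + (ctrShift L c.k : ℤ) + if i = μ then (L : ℤ) ^ c.k else 0) (gaugeAct u⁻¹ U'') (expCfg (iEta η A)) :=
    fun z ν hz hzν => (hbox z ν ⟨hz, hzν⟩).1
  have hB : ∀ z ν, BondIn (fun i => (L : ℤ) ^ c.k * x i - (ctrShift L c.k : ℤ))
      (fun i => (L : ℤ) ^ c.k * x i + (ctrShift L c.k : ℤ) + if i = μ then (L : ℤ) ^ c.k else 0) z ν → ‖iEta η A z ν‖ ≤ b :=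
    fun z ν hz => (hbox z ν hz).2
  rw [hj] at hU₁E hB hm hp hLb
  have key := logCovIter_one_eq_mlog_avgIter_loc_of_window hLs hs hd1 hG j x μ (iEta η A) hb0 hB (by rw [hLb]; exact h4)
    (by rw [hLb]; exact hc₃) u (gaugeAct u⁻¹ U'') hU₁E hm hp
  rw [hgU] at key
  rw [hj]
  exact key

end Identity

/-! ## §3 (1.135)–(1.138) as `GaugedBoundB8DZ` from a gauge transformation with Theorem 4's clauses -/

section Assembly

variable {𝔸 : Type*} [CStarAlgebra 𝔸] [Nontrivial 𝔸]

/-- (RECORD TWIN of `B8Prop6DentedCubeMemberGauged.gaugedBoundB8D_of_clauses`.) ★★ **(1.135)–(1.138) ∕ (152)–(153) AS `GaugedBoundB8DZ` AT EVERY DENTED RECORD CUBE, FROM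
A GAUGE TRANSFORMATION WITH THEOREM 4's CLAUSES**: given the dented record datum `c` in the (1.130)-regime (odd `L = 2s+1`, `s ≥ 1`), the record's Prop-4 window
`4·C₁·KZ²·α₂ ≤ 1`, `KZ·α₂ ≤ c₃(d, L)` at `α₂ = 5dLB₀(L³α₀ + 6dL²Mα₀)`, a unitary `u` (= 1 off `Ω′₀`) with (1.29) on the dented record cells (`Restr129Z`), (1.38) of record
(`IsLandau138WZ`) on `(Ω′₀, Λ′)`, the sharp (1.62)-shape on the dented tower, `w = v⁻¹u` unitary and (1.135) on the centred `□̃`, and the three norm members with print's constant: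
`GaugedBoundB8DZ L η U₀ c (7dL²(5dLB₀)Mα₀)` — (1.137)'s identity on the `Ω_k`-bonds of `□^{(k)}` by §2 + §1 at `A := mlogCfg c.k η c.sq …` (`mlogCfg_spec`), the (1.62)
constant weakened by `const_136`, assembled by `gaugedBoundB8DZ_intro`.
[cite: Balaban1985RegularSpaces, Prop. 6 (1.135)–(1.138) p.99, (1.62) p.87; Balaban1985Variational, (152)–(153) p.301; Balaban1987RG1, (0.3)–(0.4) pp.252–253] -/
theorem gaugedBoundB8D_of_clauses (hd2 : 2 ≤ d) {L s : ℕ} (hLs : L = 2 * s + 1) (hs : 1 ≤ s) {B₀ : ℝ} (hB₀ : 0 < B₀) {η : ℝ} (hη : 0 < η) {K : ℕ}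
    {Ω : ℕ → Set (Site d)} (c : CubeB8DZ d L K Ω) (U₀ : Site d → Fin d → 𝔸ˣ) (hU₀ : ∀ x κ, U₀ x κ ∈ unitaryUnits 𝔸) {α₀ : ℝ} (hα : 0 < α₀)
    (hA : InAk L c.k η α₀ Ω U₀) (hα3 : C0Z d * (α₀ * (L : ℝ) ^ 2) ≤ 1 / 3) (hα2 : 2 * (α₀ * (L : ℝ) ^ 2) ≤ c2' d L)
    (hsmall : 11 * (d : ℝ) ^ 2 * (L : ℝ) ^ 2 * α₀ + ((c.M : ℝ) + 4 * c.ρ) * d * (L : ℝ) ^ 2 * α₀ ≤ 1 / 6)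
    (h4C : 4 * (131072 * ((d : ℝ) + 1) ^ 2) * (KZ d L) ^ 2 * (5 * (d : ℝ) * L * B₀ * ((L : ℝ) ^ 3 * α₀ + 6 * d * (L : ℝ) ^ 2 * c.M * α₀)) ≤ 1)
    (hc3α : KZ d L * (5 * (d : ℝ) * L * B₀ * ((L : ℝ) ^ 3 * α₀ + 6 * d * (L : ℝ) ^ 2 * c.M * α₀)) ≤ c3 d L)
    (u : Site d → 𝔸ˣ) (hu : ∀ x, u x ∈ unitaryUnits 𝔸) (huS : ∀ x, x ∉ c.sq 0 → u x = 1)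
    (h129 : Restr129Z L c.k c.lamS (1 : Site d → Fin d → 𝔸ˣ) u)
    (hLan : IsLandau138WZ L c.k η (c.sq 0) c.lamS (1 : Site d → Fin d → 𝔸ˣ)
      (gaugeAct u⁻¹ (cutFixedZ L (tLo c.a c.ρ) (tHi c.a c.M c.ρ) U₀ c.k (ctr c.a c.M))))
    (h162 : ∀ j, j ≤ c.k → ∀ b ∈ {b : Site d × Fin d | SideTouches (c.sq j) b.1 b.2},
      gaugeAct u⁻¹ (cutFixedZ L (tLo c.a c.ρ) (tHi c.a c.M c.ρ) U₀ c.k (ctr c.a c.M)) b.1 b.2 =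
          cfgExp η (logCfg η (gaugeAct u⁻¹ (cutFixedZ L (tLo c.a c.ρ) (tHi c.a c.M c.ρ) U₀ c.k (ctr c.a c.M)))) b.1 b.2 ∧
        IsSelfAdjoint (logCfg η (gaugeAct u⁻¹ (cutFixedZ L (tLo c.a c.ρ) (tHi c.a c.M c.ρ) U₀ c.k (ctr c.a c.M))) b.1 b.2) ∧
        ‖logCfg η (gaugeAct u⁻¹ (cutFixedZ L (tLo c.a c.ρ) (tHi c.a c.M c.ρ) U₀ c.k (ctr c.a c.M))) b.1 b.2‖ ≤
          (5 * (d : ℝ) * L * B₀ * ((L : ℝ) ^ 3 * α₀ + 6 * d * (L : ℝ) ^ 2 * c.M * α₀)) * ((L : ℝ) ^ j * η)⁻¹)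
    (hw : ∀ x, ((localGaugeZ L (tLo c.a c.ρ) (tHi c.a c.M c.ρ) U₀ c.k (ctr c.a c.M))⁻¹ * u) x ∈ unitaryUnits 𝔸)
    (h135 : AgreeOn (tlo L (tLo c.a c.ρ) c.k) (thi L (tHi c.a c.M c.ρ) c.k)
      (gaugeAct ((localGaugeZ L (tLo c.a c.ρ) (tHi c.a c.M c.ρ) U₀ c.k (ctr c.a c.M))⁻¹ * u)⁻¹ U₀)
      (gaugeAct u⁻¹ (cutFixedZ L (tLo c.a c.ρ) (tHi c.a c.M c.ρ) U₀ c.k (ctr c.a c.M))))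
    (h136₂ : B8ScaledSupNorm.msup L c.k η (-(2 : ℝ)) (fun j (t : Fin d × Fin d × Site d) => SideTouches (c.sq j) t.2.2 t.2.1)
      (fun t => B8Ineq132.covDerivFwd η (1 : Site d → Fin d → 𝔸ˣ) t.1
        (fun z => mlogCfg c.k η c.sq (gaugeAct u⁻¹ (cutFixedZ L (tLo c.a c.ρ) (tHi c.a c.M c.ρ) U₀ c.k (ctr c.a c.M))) z t.2.1)
        t.2.2) ≤ 7 * d * (L : ℝ) ^ 2 * (5 * (d : ℝ) * L * B₀) * c.M * α₀)
    (h136₃ : B8ScaledSupNorm.bondNorm L c.k η (-(3 : ℝ)) c.sq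
      (fun x μ => B8Eq143PlaqExpansion.pdiv η (1 : Site d → Fin d → 𝔸ˣ) (B8Eq146AExpansion.plaqCovDeriv η (1 : Site d → Fin d → 𝔸ˣ)
        (mlogCfg c.k η c.sq (gaugeAct u⁻¹ (cutFixedZ L (tLo c.a c.ρ) (tHi c.a c.M c.ρ) U₀ c.k (ctr c.a c.M))))) μ x)
        ≤ 7 * d * (L : ℝ) ^ 2 * (5 * (d : ℝ) * L * B₀) * c.M * α₀)
    (h136₄ : B8ScaledSupNorm.bondNorm L c.k η (-(3 : ℝ)) c.sq
      (fun x μ => covLap η (1 : Site d → Fin d → 𝔸ˣ)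
        (fun z => mlogCfg c.k η c.sq (gaugeAct u⁻¹ (cutFixedZ L (tLo c.a c.ρ) (tHi c.a c.M c.ρ) U₀ c.k (ctr c.a c.M))) z μ) x)
        ≤ 7 * d * (L : ℝ) ^ 2 * (5 * (d : ℝ) * L * B₀) * c.M * α₀) :
    GaugedBoundB8DZ L η U₀ c (7 * d * (L : ℝ) ^ 2 * (5 * (d : ℝ) * L * B₀) * c.M * α₀) := by
  have hL1 : 1 ≤ L := by omega
  have hd1 : 1 ≤ d := le_trans (by norm_num) hd2
  have hLpos : (0 : ℝ) < L := by exact_mod_cast hL1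
  have hdpos : (0 : ℝ) < d := by exact_mod_cast hd1
  have hρ : 1 ≤ c.ρ := hL1.trans c.L_le_ρ
  have hM1 : 1 ≤ c.M := hρ.trans c.ρ_le_M
  have hMpos : (0 : ℝ) < c.M := by exact_mod_cast hM1
  have hLdM : (L : ℝ) ≤ d * c.M := by exact_mod_cast c.L_le_dM
  have hB0 : 0 < 5 * (d : ℝ) * L * B₀ := by positivity
  set α₂ : ℝ := 5 * (d : ℝ) * L * B₀ * ((L : ℝ) ^ 3 * α₀ + 6 * d * (L : ℝ) ^ 2 * c.M * α₀) with hα₂_def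
  have hα₂0 : 0 ≤ α₂ := by positivity
  have h16 : 16 * α₂ ≤ 1 := by
    have hC1 : (1 : ℝ) ≤ 131072 * ((d : ℝ) + 1) ^ 2 := by nlinarith [sq_nonneg ((d : ℝ) + 1), hdpos]
    have hK2 : (2 : ℝ) ≤ KZ d L := by unfold KZ; have := gZ_nonneg d L; linarith
    have hK4 : (4 : ℝ) ≤ (KZ d L) ^ 2 := by nlinarith
    have h1 : (16 : ℝ) ≤ 4 * (131072 * ((d : ℝ) + 1) ^ 2) * (KZ d L) ^ 2 := by nlinarith
    have : 16 * α₂ ≤ 4 * (131072 * ((d : ℝ) + 1) ^ 2) * (KZ d L) ^ 2 * α₂ := mul_le_mul_of_nonneg_right h1 hα₂0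
    exact this.trans h4C
  set U'' := cutFixedZ L (tLo c.a c.ρ) (tHi c.a c.M c.ρ) U₀ c.k (ctr c.a c.M) with hU''
  obtain ⟨hmem, -, -, -, -, -⟩ := thm4_hypotheses_one_cutFixed_dented_γ hLs hs hd1 c U₀ hU₀ hα hα3 hα2 hη hA hsmall
  have hU₁u : ∀ x κ, gaugeAct u⁻¹ U'' x κ ∈ unitaryUnits 𝔸 := gaugeAct_mem_of hmem fun x => (unitaryUnits 𝔸).inv_mem (hu x)
  obtain ⟨-, hrep, -⟩ := mlogCfg_spec hη hL1 c.k (1 : Site d → Fin d → 𝔸ˣ) hU₁u hα₂0 h16 c.sq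
    (fun j hj y τ hsd => ⟨(h162 j hj (y, τ) hsd).1, (h162 j hj (y, τ) hsd).2.2⟩)
  have h162k : ∀ (z : Site d) (ν : Fin d), SideTouches (c.sq c.k) z ν →
      gaugeAct u⁻¹ U'' z ν = cfgExp η (mlogCfg c.k η c.sq (gaugeAct u⁻¹ U'')) z ν ∧
        ‖mlogCfg c.k η c.sq (gaugeAct u⁻¹ U'') z ν‖ ≤ α₂ * ((L : ℝ) ^ c.k * η)⁻¹ := fun z ν hsd =>
    ⟨(hrep c.k le_rfl z ν hsd).2, by rw [(hrep c.k le_rfl z ν hsd).1]; exact (h162 c.k le_rfl (z, ν) hsd).2.2⟩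
  have h137 : ∀ (x : Site d) (μ : Fin d), bLoZ L c.a 0 0 ≤ x → x + e μ ≤ bHiZ L c.a c.M 0 0 → c.inTop x → c.inTop (x + e μ) →
      logCovIterZ L (1 : Site d → Fin d → 𝔸ˣ)
          (iEta η (mlogCfg c.k η c.sq (gaugeAct u⁻¹ U''))) c.k x μ =
        mlog ((avgIterZ L (gaugeAct (localGaugeZ L (tLo c.a c.ρ) (tHi c.a c.M c.ρ) U₀ c.k (ctr c.a c.M)) U₀) c.k x μ : 𝔸ˣ) : 𝔸) := by
    intro x μ hx hx' hix hix'
    rw [← avgIter_cutFixed_eq_avgIter_axial hLs c.k U₀ c.a c.ρ x μ hx hx']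
    exact logCovIter_eq_mlog_avgIter_dentedMember hd2 hLs hs c U₀ hU₀ hα hα3 hα2 hη hA hsmall u h129 _ hα₂0 h4C hc3α h162k x μ hx hx' hix hix'
  have h162' : ∀ j, j ≤ c.k → ∀ b ∈ {b : Site d × Fin d | SideTouches (c.sq j) b.1 b.2},
      gaugeAct u⁻¹ U'' b.1 b.2 = cfgExp η (logCfg η (gaugeAct u⁻¹ U'')) b.1 b.2 ∧ IsSelfAdjoint (logCfg η (gaugeAct u⁻¹ U'') b.1 b.2) ∧
        ‖logCfg η (gaugeAct u⁻¹ U'') b.1 b.2‖ ≤ (7 * d * (L : ℝ) ^ 2 * (5 * (d : ℝ) * L * B₀) * c.M * α₀) * ((L : ℝ) ^ j * η)⁻¹ := by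
    intro j hj b hb
    obtain ⟨h1, h2, h3⟩ := h162 j hj b hb
    refine ⟨h1, h2, h3.trans ?_⟩
    have hη0 : 0 ≤ ((L : ℝ) ^ j * η)⁻¹ := by positivity
    exact mul_le_mul_of_nonneg_right (const_136 hLpos hα hB0.le hLdM) hη0
  exact gaugedBoundB8DZ_intro L η U₀ c _ u hu huS h129 hLan h162' hw h135 h136₂ h136₃ h136₄ h137

end Assembly

end Literature.MathematicalPhysics.QuantumFieldTheory.Balaban1983to89.B8Prop6DentedCubeMemberGaugedRec

end
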